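import Literature.AlgebraicGeometry.Resolution.AlterationsCurves
import Literature.AlgebraicGeometry.Resolution.AlterationsProofs
import Literature.AlgebraicGeometry.Motives.SymmetricPowerProjective
import Literature.AlgebraicGeometry.Motives.RatFnBirational
import HarnessLib

/-!
# `WildQuotients.SummitReduction` (stmt-ResolutionOfSingularities-16324), line `FramePerfect`:
# the trivial cases of the de Jong stub (regular `X`, and normal `X` of dimension `≤ 1`)

Route `ResolutionOfSingularities/WildQuotients`, crux `SummitReduction`. The line's one open stub,
`stub_deJong1997_galoisAlteration_perfect` (skeleton `Cruxes/SummitReduction/Lines/FramePerfect.lean`),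
asks, for a normal projective integral `X` over a perfect field of characteristic `p`, for de Jong's
GALOIS ALTERATION DATUM: a finite group `G`, a regular integral `X₁` all of whose finite subsets lie
in affine opens, a faithful `ρ : G →* Aut X₁`, and a `G`-invariant alteration `π : X₁ ⟶ X` with
`K(X) ⊂ K(X₁)^G` purely inseparable (de Jong 1997, (5.12.1) / Thm. 5.13 / Cor. 5.15).

This helper file (supports the crux; it does not close it) records the cases in which the datum is
free, i.e. the base of de Jong's induction on the dimension (de Jong 1996, 4.3: "the case
`dim X = 1` … by taking `X₁` to be the normalization of `X`"):

* `galoisAlterationDatum_of_isIso_morphismRestrict`: a proper BIRATIONAL `π : X₁ ⟶ X` from a regular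
  integral `X₁` with finite subsets in affine opens (e.g. a quasi-projective resolution of `X`) is a
  datum with `G = 1`;
* `galoisAlterationDatum_of_isRegular`: a regular projective integral `X` is its own datum;
* `galoisAlterationDatum_of_dim_le_one`: so is a normal projective integral `X` of dimension `≤ 1`
  (normal of dimension `≤ 1` is regular, `Scheme.IsRegular.of_isIntegrallyClosed_of_dim_le_one`).

Everything is over an arbitrary field (no characteristic or perfectness hypothesis is used).
-/

set_option linter.dupNamespace false

noncomputable section

open CategoryTheory AlgebraicGeometry TopologicalSpace
open Literature.AlgebraicGeometry.Resolution
open Literature.AlgebraicGeometry.Motives (RatFn.functionFieldMap)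
open Literature.AlgebraicGeometry

namespace Summit.ResolutionOfSingularities.ResolutionOfSingularities.Theorems

/-- Finite subsets of a projective scheme over a field lie in affine opens (graded prime
avoidance; the tree's `IsProjectiveOver.finiteSubsetsInAffineOpens`, unbundled to `IsAffineOpen`).
[cite: MumfordAV1970, §7 Remark p. 69] -/
theorem finset_subset_affineOpen_of_isProjectiveOver {k : Type} [Field k] {X : Scheme.{0}}
    (f : X ⟶ Spec (.of k)) (hproj : Motives.IsProjectiveOver (Over.mk f)) (S : Finset X) :
    ∃ U : X.Opens, IsAffineOpen U ∧ (↑S : Set X) ⊆ U := by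
  obtain ⟨W, hW, hmem⟩ := hproj.finiteSubsetsInAffineOpens.exists_open S
  have hW' : IsAffineHom (W.ι ≫ f) := hW
  exact ⟨W, @isAffine_of_isAffineHom _ _ (W.ι ≫ f) hW' inferInstance, fun t ht => hmem t ht⟩

/-- **A regular quasi-projective modification is a Galois alteration datum with trivial group.**
If `π : X₁ ⟶ X` is proper, an isomorphism over a non-empty open `U ⊆ X`, with `X₁` regular
integral and all finite subsets of `X₁` in affine opens, then `(G, X₁, ρ, π) = (1, X₁, 1, π)` is a
datum as demanded by de Jong 1997 (5.12.1): `π` is an alteration, the trivial group acts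
faithfully, and `K(X₁) = K(X)`. [cite: DeJong1996, 4.3, p. 66] -/
theorem galoisAlterationDatum_of_isIso_morphismRestrict {X X₁ : Scheme.{0}} [IsIntegral X]
    [IsIntegral X₁] (π : X₁ ⟶ X) [IsProper π] (hreg : Scheme.IsRegular X₁)
    (hAF : ∀ S : Finset X₁, ∃ U : X₁.Opens, IsAffineOpen U ∧ (↑S : Set X₁) ⊆ U)
    (U : X.Opens) (hU : (U : Set X).Nonempty) [IsIso (π ∣_ U)] :
    ∃ (G : Type) (_ : Group G) (_ : Finite G) (X₂ : Scheme.{0}) (_ : IsIntegral X₂)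
      (ρ : G →* Aut X₂) (π' : X₂ ⟶ X) (_ : IsDominant π'),
      IsAlteration π' ∧ Scheme.IsRegular X₂ ∧ Function.Injective ρ ∧
      (∀ g : G, (ρ g).hom ≫ π' = π') ∧
      (∀ S : Finset X₂, ∃ U : X₂.Opens, IsAffineOpen U ∧ (↑S : Set X₂) ⊆ U) ∧
      (∀ a : X₂.functionField, (∀ g : G, RatFn.functionFieldMap (ρ g).hom a = a) →
        ∃ n : ℕ, a ^ ringExpChar X.functionField ^ n ∈ Set.range (RatFn.functionFieldMap π')) := by
  -- `U ⊆ range π`, so `π` is dominant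
  have hsub : (U : Set X) ⊆ Set.range π.base := by
    intro u hu
    obtain ⟨x, hx⟩ := (π ∣_ U).surjective ⟨u, hu⟩
    refine ⟨x.1, ?_⟩
    have := morphismRestrict_base_coe π U x
    rw [hx] at this
    exact this.symm
  have hUd : Dense (U : Set X) := U.isOpen.dense hU
  haveI hdom : IsDominant π := ⟨hUd.mono hsub⟩
  have hπ : IsAlteration π :=
    { isIntegral := inferInstance
      isProper := inferInstance
      isDominant := hdom
      exists_isFinite := ⟨U, hU, inferInstance⟩ }
  -- the preimage of `U` is non-empty, hence dense: `K(X₁) = K(X)`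
  have hU' : Dense ((π ⁻¹ᵁ U : X₁.Opens) : Set X₁) := by
    obtain ⟨u, hu⟩ := hU
    obtain ⟨x, -⟩ := (π ∣_ U).surjective ⟨u, hu⟩
    exact (π ⁻¹ᵁ U).isOpen.dense ⟨x.1, x.2⟩
  have hbij := Motives.RatFn.functionFieldMap_bijective_of_isIso_morphismRestrict π U hUd hU'
  have h1 : ∀ g : PUnit, ((1 : PUnit →* Aut X₁) g).hom = 𝟙 X₁ := fun _ => rfl
  refine ⟨PUnit, inferInstance, inferInstance, X₁, inferInstance, 1, π, hdom, hπ, hreg,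
    fun a b _ => Subsingleton.elim a b, fun g => by rw [h1, Category.id_comp], hAF, ?_⟩
  intro a _
  obtain ⟨b, hb⟩ := hbij.2 a
  exact ⟨0, b, by rw [pow_zero, pow_one]; exact hb⟩

/-- **A regular projective integral variety is its own Galois alteration datum** (trivial group,
`π = 𝟙`). [cite: DeJong1996, 4.3, p. 66] -/
theorem galoisAlterationDatum_of_isRegular {k : Type} [Field k] (X : Scheme.{0}) [IsIntegral X]
    (f : X ⟶ Spec (.of k)) (hproj : Motives.IsProjectiveOver (Over.mk f))
    (hreg : Scheme.IsRegular X) :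
    ∃ (G : Type) (_ : Group G) (_ : Finite G) (X₁ : Scheme.{0}) (_ : IsIntegral X₁)
      (ρ : G →* Aut X₁) (π : X₁ ⟶ X) (_ : IsDominant π),
      IsAlteration π ∧ Scheme.IsRegular X₁ ∧ Function.Injective ρ ∧
      (∀ g : G, (ρ g).hom ≫ π = π) ∧
      (∀ S : Finset X₁, ∃ U : X₁.Opens, IsAffineOpen U ∧ (↑S : Set X₁) ⊆ U) ∧
      (∀ a : X₁.functionField, (∀ g : G, RatFn.functionFieldMap (ρ g).hom a = a) →
        ∃ n : ℕ, a ^ ringExpChar X.functionField ^ n ∈ Set.range (RatFn.functionFieldMap π)) := by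
  obtain ⟨x⟩ := (inferInstance : Nonempty X)
  exact galoisAlterationDatum_of_isIso_morphismRestrict (𝟙 X) hreg
    (finset_subset_affineOpen_of_isProjectiveOver f hproj) ⊤ ⟨x, trivial⟩

/-- **The base of de Jong's induction**: a NORMAL projective integral variety of dimension `≤ 1`
over a field is its own Galois alteration datum, because normal of dimension `≤ 1` is regular
(de Jong 1996, 4.3; Liu 2002, Prop. 4.1.12). [cite: DeJong1996, 4.3, p. 66] -/
theorem galoisAlterationDatum_of_dim_le_one {k : Type} [Field k] (X : Scheme.{0}) [IsIntegral X]
    (f : X ⟶ Spec (.of k)) [LocallyOfFiniteType f] (hproj : Motives.IsProjectiveOver (Over.mk f))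
    (hN : ∀ x : X, IsIntegrallyClosed (X.presheaf.stalk x)) (hdim : topologicalKrullDim X ≤ 1) :
    ∃ (G : Type) (_ : Group G) (_ : Finite G) (X₁ : Scheme.{0}) (_ : IsIntegral X₁)
      (ρ : G →* Aut X₁) (π : X₁ ⟶ X) (_ : IsDominant π),
      IsAlteration π ∧ Scheme.IsRegular X₁ ∧ Function.Injective ρ ∧
      (∀ g : G, (ρ g).hom ≫ π = π) ∧
      (∀ S : Finset X₁, ∃ U : X₁.Opens, IsAffineOpen U ∧ (↑S : Set X₁) ⊆ U) ∧
      (∀ a : X₁.functionField, (∀ g : G, RatFn.functionFieldMap (ρ g).hom a = a) →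
        ∃ n : ℕ, a ^ ringExpChar X.functionField ^ n ∈ Set.range (RatFn.functionFieldMap π)) := by
  haveI : IsLocallyNoetherian X := LocallyOfFiniteType.isLocallyNoetherian f
  exact galoisAlterationDatum_of_isRegular X f hproj
    (Scheme.IsRegular.of_isIntegrallyClosed_of_dim_le_one hN hdim)

end Summit.ResolutionOfSingularities.ResolutionOfSingularities.Theorems

end
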